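import Mathlib
import Summits.ValiantsHypothesis.ValiantsHypothesis.Theorems.NewtonUnitEquationsNewtonTauWeakK3Frame

/-!
# `NewtonTauWeak` (stmt-ValiantsHypothesis-5904), line `binomial-normal-form`, stub `fixedKCoincidence_t2_K3`:
# division by the lowest product — truncated inverses and heavy remainders

Support file for the registered sub-stub `fixedKCoincidence_t2_K3` of the crux
`Summit.ValiantsHypothesis.ValiantsHypothesis.Theses.NewtonUnitEquations.NewtonTauWeak`.

The corner model of the `K = 3` rigidity lemma (`corner_rigidity`, lead c2) normalises one of three separated
products `Π_e P_{l,e}(X^{E_e})` to the constant `1` ("division by the lowest product",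
`Cruxes/NewtonTauWeak/Lines/binomial-normal-form-ltc.md` §4).  Here this is done without power series: for a
univariate `P` with `P(0) = 1` the polynomial `Q = Σ_{i ≤ D'} (1 - P)^i` satisfies `P Q = 1 + s^{D'+1} R`
(`k2_exists_invTrunc`); a product is truncated at degree `D'` (`k2_exists_trunc`), and orders at the corner are
read off through the truncation (`k2_isOrder_trunc_iff`).  In the Laurent ring `ℂ[ℤ²]` every discarded term is
HEAVY (weight `≥ (D'+1)·μ` when all directions weigh `≥ μ`), and a product of "light + heavy" factors is the
light product plus a heavy remainder (`k2_prod_add_heavy`).  The packaged statement is `k2_division`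
(registered helper stub): multiplying the three products by `Π_e Q_e(X^{E_e})` turns product `l₀` into `1`
and the others into separated products of truncated quotients `V_{l,e}` whose corner orders are those of
`P_{l,e} - P_{l₀,e}`, up to heavy remainders.

No definitions. [folklore]
-/

-- the namespace mandated for this Theorems file repeats the component `ValiantsHypothesis`
set_option linter.dupNamespace false

noncomputable section

open scoped BigOperators Polynomial
open AddMonoidAlgebra

namespace Summit.ValiantsHypothesis.ValiantsHypothesis.Theorems.NewtonTauWeakCorner

/-! ## §1 Univariate truncation and truncated inverses -/

/-- **Truncation.** Every polynomial is its truncation at degree `D` plus a multiple of `s^{D+1}`. [folklore] -/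
theorem k2_exists_trunc (P : ℂ[X]) (D : ℕ) :
    ∃ U R : ℂ[X], P = U + Polynomial.X ^ (D + 1) * R ∧ U.natDegree ≤ D ∧ ∀ i ≤ D, U.coeff i = P.coeff i := by
  set U : ℂ[X] := ∑ i ∈ Finset.range (D + 1), Polynomial.monomial i (P.coeff i) with hU
  have hUc : ∀ j, U.coeff j = if j ≤ D then P.coeff j else 0 := by
    intro j
    rw [hU, Polynomial.finsetSum_coeff]
    simp only [Polynomial.coeff_monomial]
    rw [Finset.sum_ite_eq' (Finset.range (D + 1)) j (fun i => P.coeff i)]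
    simp only [Finset.mem_range, Nat.lt_succ_iff]
  have hdvd : Polynomial.X ^ (D + 1) ∣ P - U := by
    rw [Polynomial.X_pow_dvd_iff]
    intro d hd
    rw [Polynomial.coeff_sub, hUc d, if_pos (Nat.lt_succ_iff.mp hd), sub_self]
  obtain ⟨R, hR⟩ := hdvd
  refine ⟨U, R, by rw [← hR]; ring, ?_, fun i hi => by rw [hUc i, if_pos hi]⟩
  rw [hU]
  exact Polynomial.natDegree_sum_le_of_forall_le _ _ fun i hi =>
    (Polynomial.natDegree_monomial_le _).trans (Nat.lt_succ_iff.mp (Finset.mem_range.mp hi))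

/-- **Truncated inverse.** For `P(0) = 1`, `Q = Σ_{i ≤ D} (1 - P)^i` has `Q(0) = 1` and `P Q = 1 + s^{D+1} R`.
[folklore] -/
theorem k2_exists_invTrunc (P : ℂ[X]) (hP : P.coeff 0 = 1) (D : ℕ) :
    ∃ Q R : ℂ[X], Q.coeff 0 = 1 ∧ P * Q = 1 + Polynomial.X ^ (D + 1) * R := by
  set Q : ℂ[X] := ∑ i ∈ Finset.range (D + 1), (1 - P) ^ i with hQ
  have hgeom : Q * ((1 - P) - 1) = (1 - P) ^ (D + 1) - 1 := geom_sum_mul (1 - P) (D + 1)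
  have hX : Polynomial.X ∣ 1 - P := by
    rw [Polynomial.X_dvd_iff, Polynomial.coeff_sub, Polynomial.coeff_one_zero, hP, sub_self]
  obtain ⟨R₀, hR₀⟩ := pow_dvd_pow_of_dvd hX (D + 1)
  refine ⟨Q, -R₀, ?_, ?_⟩
  · rw [hQ, Polynomial.finsetSum_coeff]
    have h0 : ∀ i ∈ Finset.range (D + 1), ((1 - P) ^ i : ℂ[X]).coeff 0 = if i = 0 then 1 else 0 := by
      intro i _
      rw [Polynomial.coeff_zero_eq_eval_zero, Polynomial.eval_pow, Polynomial.eval_sub, Polynomial.eval_one,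
        ← Polynomial.coeff_zero_eq_eval_zero, hP, sub_self, zero_pow_eq]
    rw [Finset.sum_congr rfl h0, Finset.sum_ite_eq']
    simp
  · have : P * Q = 1 - (1 - P) ^ (D + 1) := by linear_combination (-1 : ℂ[X]) * hgeom
    rw [this, hR₀]
    ring

/-- Coefficients of a product below a truncation order where one factor is `1 + s^{D+1} R`. [folklore] -/
theorem k2_coeff_mul_oneAdd (A R : ℂ[X]) (D i : ℕ) (hi : i ≤ D) :
    (A * (1 + Polynomial.X ^ (D + 1) * R)).coeff i = A.coeff i := by
  rw [mul_add, mul_one, Polynomial.coeff_add, ← mul_assoc, mul_comm A, mul_assoc, Polynomial.coeff_X_pow_mul']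
  rw [if_neg (by omega), add_zero]

/-- **Orders through a truncated quotient.** Let `P₂ Q = 1 + s^{D+1} R`, `P₁(0) = P₂(0) = 1`,
`deg P₁, deg P₂ ≤ D`, and let `U` agree with `P₁ Q` up to degree `D` and have degree `≤ D`.  Then the corner
orders of `U` are exactly those of `P₁ - P₂`. [folklore] -/
theorem k2_isOrder_trunc_iff (P₁ P₂ Q R U : ℂ[X]) (D : ℕ) (h1 : P₁.coeff 0 = 1) (h2 : P₂.coeff 0 = 1)
    (hQ0 : Q.coeff 0 = 1) (hPQ : P₂ * Q = 1 + Polynomial.X ^ (D + 1) * R)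
    (hD1 : P₁.natDegree ≤ D) (hD2 : P₂.natDegree ≤ D)
    (hUD : U.natDegree ≤ D) (hU : ∀ i ≤ D, U.coeff i = (P₁ * Q).coeff i) (k : ℕ) :
    IsOrder U k ↔ IsOrder (P₁ - P₂) k := by
  -- coefficients of `U` below `D` in terms of `Δ = P₁ - P₂`
  have hUi : ∀ i ≤ D, U.coeff i = ((P₁ - P₂) * Q).coeff i + if i = 0 then 1 else 0 := by
    intro i hi
    rw [hU i hi, show P₁ * Q = (P₁ - P₂) * Q + P₂ * Q by ring, Polynomial.coeff_add, hPQ,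
      Polynomial.coeff_add, Polynomial.coeff_one, Polynomial.coeff_X_pow_mul',
      if_neg (show ¬ (D + 1 ≤ i) by omega), add_zero]
  have hΔ0 : (P₁ - P₂).coeff 0 = 0 := by rw [Polynomial.coeff_sub, h1, h2, sub_self]
  -- degree of `Δ`
  have hΔD : (P₁ - P₂).natDegree ≤ D := (Polynomial.natDegree_sub_le _ _).trans (max_le hD1 hD2)
  -- forward: an order of `Δ` is an order of `U`
  have fwd : ∀ k, IsOrder (P₁ - P₂) k → IsOrder U k := by
    intro k hk
    have hkD : k ≤ D := hk.le_natDegree.trans hΔD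
    -- coefficients of `Δ Q` below `k` vanish, at `k` equal `Δ_k`
    have hlow : ∀ i, i < k → ((P₁ - P₂) * Q).coeff i = 0 := by
      intro i hik
      rw [Polynomial.coeff_mul]
      refine Finset.sum_eq_zero fun x hx => ?_
      have hx1 : x.1 ≤ i := by
        have := Finset.HasAntidiagonal.mem_antidiagonal.mp hx; omega
      have : (P₁ - P₂).coeff x.1 = 0 := by
        rcases Nat.eq_zero_or_pos x.1 with h0 | hpos
        · rw [h0]; exact hΔ0
        · exact hk.2.2 x.1 hpos (by omega)
      rw [this, zero_mul]
    have hat : ((P₁ - P₂) * Q).coeff k = (P₁ - P₂).coeff k := by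
      rw [Polynomial.coeff_mul, Finset.Nat.sum_antidiagonal_eq_sum_range_succ
        (fun a b => (P₁ - P₂).coeff a * Q.coeff b), Finset.sum_range_succ, Nat.sub_self, hQ0, mul_one]
      rw [Finset.sum_eq_zero, zero_add]
      intro i hi
      have hik : i < k := Finset.mem_range.mp hi
      have : (P₁ - P₂).coeff i = 0 := by
        rcases Nat.eq_zero_or_pos i with h0 | hpos
        · rw [h0]; exact hΔ0
        · exact hk.2.2 i hpos hik
      rw [this, zero_mul]
    refine ⟨hk.1, ?_, ?_⟩
    · rw [hUi k hkD, hat, if_neg (by have := hk.1; omega), add_zero]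
      exact hk.2.1
    · intro j hj hjk
      rw [hUi j (by omega), hlow j hjk, if_neg (by omega), add_zero]
  constructor
  · intro hUk
    -- `Δ ≠ 0`, else `U` has no positive-order coefficient
    by_cases hΔ : P₁ - P₂ = 0
    · exfalso
      have hk1 := hUk.1
      have hkc := hUk.2.1
      by_cases hkD : k ≤ D
      · rw [hUi k hkD, hΔ, zero_mul, Polynomial.coeff_zero, if_neg (by omega), add_zero] at hkc
        exact hkc rfl
      · push Not at hkD
        exact hkc (Polynomial.coeff_eq_zero_of_natDegree_lt (lt_of_le_of_lt hUD hkD))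
    · -- `Δ` has an order `k'`, which is an order of `U`; orders are unique
      have hex : ∃ j, 1 ≤ j ∧ (P₁ - P₂).coeff j ≠ 0 := by
        by_contra hall
        push Not at hall
        apply hΔ
        ext j
        rcases Nat.eq_zero_or_pos j with h0 | hpos
        · rw [h0, hΔ0, Polynomial.coeff_zero]
        · rw [hall j hpos, Polynomial.coeff_zero]
      obtain ⟨k', hk'⟩ := exists_isOrder hex
      have := (hUk.unique (fwd k' hk')).symm
      subst this
      exact hk'
  · exact fwd k

/-! ## §2 Heavy remainders in the Laurent ring -/

/-- A pushed multiple of `s^{n}` is a shifted push: `(s^n R)(X^E) = X^{nE} · R(X^E)`, so all its exponents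
weigh at least `n ⟨w, E⟩`. [folklore] -/
theorem k2_heavy_eval₂_X_pow_mul (w : Fin 2 → ℝ) (E : Fin 2 → ℤ) (hE : 0 < wt w E) (n : ℕ) (R : ℂ[X]) :
    ∀ u ∈ (Polynomial.eval₂ (singleZeroRingHom (R := ℂ) (M := Fin 2 → ℤ)) (single E (1 : ℂ))
      (Polynomial.X ^ n * R)).coeff.support, (n : ℝ) * wt w E ≤ wt w u := by
  rw [Polynomial.eval₂_mul, Polynomial.eval₂_X_pow, single_pow, one_pow]
  have h1 : ∀ u ∈ (single (n • E) (1 : ℂ) : AddMonoidAlgebra ℂ (Fin 2 → ℤ)).coeff.support,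
      (n : ℝ) * wt w E ≤ wt w u := by
    intro u hu
    rw [k2_mem_support_single hu, ← natCast_zsmul, wt_zsmul]
    push_cast
    exact le_rfl
  have := k2_wtGE_mul w h1 (k2_wtGE_eval₂ w E hE R)
  simpa using this

/-- **Light times heavy.** A finite product of factors `a_e + h_e` with `supp a_e` of weight `≥ 0` and
`supp h_e` of weight `≥ Ω ≥ 0` is `Π_e a_e` plus a remainder of weight `≥ Ω`. [folklore] -/
theorem k2_prod_add_heavy (w : Fin 2 → ℝ) {ι : Type*} (t : Finset ι)
    (a h : ι → AddMonoidAlgebra ℂ (Fin 2 → ℤ)) (Ω : ℝ) (hΩ : 0 ≤ Ω)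
    (ha : ∀ i ∈ t, ∀ u ∈ (a i).coeff.support, 0 ≤ wt w u)
    (hh : ∀ i ∈ t, ∀ u ∈ (h i).coeff.support, Ω ≤ wt w u) :
    ∃ H : AddMonoidAlgebra ℂ (Fin 2 → ℤ), (∏ i ∈ t, (a i + h i)) = (∏ i ∈ t, a i) + H ∧
      ∀ u ∈ H.coeff.support, Ω ≤ wt w u := by
  classical
  induction t using Finset.induction_on with
  | empty => exact ⟨0, by simp, fun u hu => by simp at hu⟩
  | insert i t hi ih =>
    obtain ⟨H, hH, hHw⟩ := ih (fun j hj => ha j (Finset.mem_insert_of_mem hj))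
      (fun j hj => hh j (Finset.mem_insert_of_mem hj))
    have hai := ha i (Finset.mem_insert_self i t)
    have hhi := hh i (Finset.mem_insert_self i t)
    have hPa : ∀ u ∈ (∏ j ∈ t, a j).coeff.support, 0 ≤ wt w u :=
      k2_wtGE_prod w t a fun j hj => ha j (Finset.mem_insert_of_mem hj)
    refine ⟨a i * H + h i * ((∏ j ∈ t, a j) + H), ?_, ?_⟩
    · rw [Finset.prod_insert hi, Finset.prod_insert hi, hH]; ring
    · refine k2_wtGE_add w ?_ ?_
      · have := k2_wtGE_mul w hai hHw
        simpa using this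
      · have h2 : ∀ u ∈ ((∏ j ∈ t, a j) + H).coeff.support, 0 ≤ wt w u :=
          k2_wtGE_add w hPa fun u hu => hΩ.trans (hHw u hu)
        have := k2_wtGE_mul w hhi h2
        simpa using this

/-- Separated products are multiplicative in the univariate factors. [folklore] -/
theorem k2_sepProd_mul {s : ℕ} (E : Fin s → Fin 2 → ℤ) (P Q : Fin s → ℂ[X]) :
    (∏ e, Polynomial.eval₂ (singleZeroRingHom (R := ℂ) (M := Fin 2 → ℤ)) (single (E e) (1 : ℂ)) (P e)) *
      (∏ e, Polynomial.eval₂ (singleZeroRingHom (R := ℂ) (M := Fin 2 → ℤ)) (single (E e) (1 : ℂ)) (Q e))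
      = ∏ e, Polynomial.eval₂ (singleZeroRingHom (R := ℂ) (M := Fin 2 → ℤ)) (single (E e) (1 : ℂ))
        (P e * Q e) := by
  rw [← Finset.prod_mul_distrib]
  refine Finset.prod_congr rfl fun e _ => ?_
  rw [Polynomial.eval₂_mul]

/-- A separated product of constant factors `1` is `1`. [folklore] -/
theorem k2_sepProd_one {s : ℕ} (E : Fin s → Fin 2 → ℤ) :
    (∏ e, Polynomial.eval₂ (singleZeroRingHom (R := ℂ) (M := Fin 2 → ℤ)) (single (E e) (1 : ℂ))
      ((fun _ => (1 : ℂ[X])) e)) = 1 :=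
  Finset.prod_eq_one fun e _ => by simp

/-! ## §3 Division by one of three separated products -/

/-- **Division (registered helper stub `k2_division`).**  Three separated products
`Π_e P_{l,e}(X^{E_e})` (`l < 3`) with `P_{l,e}(0) = 1`, `deg P_{l,e} ≤ D₀`, over directions of weight
`≥ μ > 0`, a divisor index `l₀` and a truncation order `D' ≥ D₀`.  There are a unit-like Laurent polynomial
`Qx` (constant term `1`, all other exponents of positive weight), univariate `V_{l,e}` with `V_{l,e}(0) = 1`,
`deg V_{l,e} ≤ D'`, `V_{l₀,e} = 1`, whose corner orders are those of `P_{l,e} - P_{l₀,e}`, and heavy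
remainders `H_l` (weight `≥ (D'+1) μ`) with `(Π_e P_{l,e}(X^{E_e})) · Qx = Π_e V_{l,e}(X^{E_e}) + H_l`.
[folklore; the division step of `Cruxes/NewtonTauWeak/Lines/binomial-normal-form-ltc.md` §4] -/
theorem k2_division {s : ℕ} (E : Fin s → Fin 2 → ℤ) (w : Fin 2 → ℝ) (μ : ℝ) (hμ : 0 < μ)
    (hw : ∀ e, μ ≤ wt w (E e)) (P : Fin 3 → Fin s → ℂ[X]) (hP0 : ∀ l e, (P l e).coeff 0 = 1)
    (D₀ : ℕ) (hPD : ∀ l e, (P l e).natDegree ≤ D₀) (l₀ : Fin 3) (D' : ℕ) (hD' : D₀ ≤ D') :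
    ∃ (Qx : AddMonoidAlgebra ℂ (Fin 2 → ℤ)) (V : Fin 3 → Fin s → ℂ[X])
      (H : Fin 3 → AddMonoidAlgebra ℂ (Fin 2 → ℤ)),
      Qx.coeff 0 = 1 ∧ (∀ z ∈ Qx.coeff.support, z ≠ 0 → 0 < wt w z) ∧
      (∀ l e, (V l e).coeff 0 = 1) ∧ (∀ l e, (V l e).natDegree ≤ D') ∧ (∀ e, V l₀ e = 1) ∧
      (∀ l e k, IsOrder (V l e) k ↔ IsOrder (P l e - P l₀ e) k) ∧
      (∀ l, (∏ e, Polynomial.eval₂ (singleZeroRingHom (R := ℂ) (M := Fin 2 → ℤ)) (single (E e) (1 : ℂ))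
          (P l e)) * Qx
        = (∏ e, Polynomial.eval₂ (singleZeroRingHom (R := ℂ) (M := Fin 2 → ℤ)) (single (E e) (1 : ℂ))
          (V l e)) + H l) ∧
      (∀ l, ∀ u ∈ (H l).coeff.support, ((D' : ℝ) + 1) * μ ≤ wt w u) := by
  have hwpos : ∀ e, 0 < wt w (E e) := fun e => lt_of_lt_of_le hμ (hw e)
  -- truncated inverses of the divisor's factors
  choose Q R hQ0 hPQ using fun e => k2_exists_invTrunc (P l₀ e) (hP0 l₀ e) D'
  -- truncations of the quotients
  choose V R' hV hVD hVc using fun l e => k2_exists_trunc (P l e * Q e) D'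
  -- a degree bound for the `Q e`
  obtain ⟨DQ, hDQ⟩ : ∃ DQ : ℕ, ∀ e, (Q e).natDegree ≤ DQ :=
    ⟨Finset.univ.sup fun e => (Q e).natDegree, fun e =>
      Finset.le_sup (f := fun e => (Q e).natDegree) (Finset.mem_univ e)⟩
  set Qx : AddMonoidAlgebra ℂ (Fin 2 → ℤ) :=
    ∏ e, Polynomial.eval₂ (singleZeroRingHom (R := ℂ) (M := Fin 2 → ℤ)) (single (E e) (1 : ℂ)) (Q e)
    with hQx
  -- the heavy remainders, factor by factor
  have key : ∀ l, ∃ Hl : AddMonoidAlgebra ℂ (Fin 2 → ℤ),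
      (∏ e, Polynomial.eval₂ (singleZeroRingHom (R := ℂ) (M := Fin 2 → ℤ)) (single (E e) (1 : ℂ))
          (P l e)) * Qx
        = (∏ e, Polynomial.eval₂ (singleZeroRingHom (R := ℂ) (M := Fin 2 → ℤ)) (single (E e) (1 : ℂ))
          (V l e)) + Hl ∧
      ∀ u ∈ Hl.coeff.support, ((D' : ℝ) + 1) * μ ≤ wt w u := by
    intro l
    rw [hQx, k2_sepProd_mul]
    have hfac : ∀ e, Polynomial.eval₂ (singleZeroRingHom (R := ℂ) (M := Fin 2 → ℤ)) (single (E e) (1 : ℂ))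
        (P l e * Q e)
        = Polynomial.eval₂ (singleZeroRingHom (R := ℂ) (M := Fin 2 → ℤ)) (single (E e) (1 : ℂ)) (V l e)
          + Polynomial.eval₂ (singleZeroRingHom (R := ℂ) (M := Fin 2 → ℤ)) (single (E e) (1 : ℂ))
            (Polynomial.X ^ (D' + 1) * R' l e) := by
      intro e
      rw [← Polynomial.eval₂_add, ← hV l e]
    simp_rw [hfac]
    obtain ⟨Hl, hHl, hHw⟩ := k2_prod_add_heavy w Finset.univ
      (fun e => Polynomial.eval₂ (singleZeroRingHom (R := ℂ) (M := Fin 2 → ℤ)) (single (E e) (1 : ℂ)) (V l e))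
      (fun e => Polynomial.eval₂ (singleZeroRingHom (R := ℂ) (M := Fin 2 → ℤ)) (single (E e) (1 : ℂ))
        (Polynomial.X ^ (D' + 1) * R' l e))
      (((D' : ℝ) + 1) * μ) (by positivity)
      (fun e _ => k2_wtGE_eval₂ w (E e) (hwpos e) (V l e))
      (fun e _ u hu => by
        have h := k2_heavy_eval₂_X_pow_mul w (E e) (hwpos e) (D' + 1) (R' l e) u hu
        push_cast at h
        exact le_trans (mul_le_mul_of_nonneg_left (hw e) (by positivity)) h)
    exact ⟨Hl, hHl, hHw⟩
  choose H hH hHw using key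
  refine ⟨Qx, V, H, ?_, ?_, ?_, hVD, ?_, ?_, hH, hHw⟩
  · exact k2_coeff_sepProd_zero E w hwpos Q hQ0 hDQ
  · intro z hz hz0
    exact (k2_wt_of_mem_support_sepProd E w hwpos Q hDQ hz).2 hz0
  · intro l e
    rw [hVc l e 0 (Nat.zero_le _), Polynomial.mul_coeff_zero, hP0, hQ0, mul_one]
  · intro e
    ext i
    by_cases hi : i ≤ D'
    · rw [hVc l₀ e i hi, hPQ e, Polynomial.coeff_add, Polynomial.coeff_X_pow_mul',
        if_neg (show ¬ (D' + 1 ≤ i) by omega), add_zero]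
    · push Not at hi
      rw [Polynomial.coeff_eq_zero_of_natDegree_lt (lt_of_le_of_lt (hVD l₀ e) hi), Polynomial.coeff_one,
        if_neg (by omega)]
  · intro l e k
    exact k2_isOrder_trunc_iff (P l e) (P l₀ e) (Q e) (R e) (V l e) D' (hP0 l e) (hP0 l₀ e) (hQ0 e) (hPQ e)
      ((hPD l e).trans hD') ((hPD l₀ e).trans hD') (hVD l e) (hVc l e) k

end Summit.ValiantsHypothesis.ValiantsHypothesis.Theorems.NewtonTauWeakCorner

end
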